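import Mathlib
import HarnessLib
import Summits.CriticalPhenomena.Ising3DConformalLimit.Theses.FKParityRobustness
import Literature.Probability.LatticeModels.LoopO1

/-!
# Crux-ideate sketches for `IndependentStrandsJoin` (item stmt-CriticalPhenomena-14625), ideator 1, round 1

First lemmas of three idea cards, stated over existing declarations (no proofs required; they must
elaborate).  All finite-graph statements below were checked by exact enumeration on the cube `Q₃`
with its inscribed tetrahedron and on random graphs (folder `toy/`).

* Card `xor-switching-sandwich`: `NoJoinSwitch` (T-join switching identity), `TetraSandwich`,
  `JoinFromU4Box` (the transfer: lattice clause (iii) at tetrahedra ⟹ the crux).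
* Card `union-shadow-exact`: `UnionShadowIdentity`, `OnePointSwitch`, `LocalAttach`.
* Card `thin-target-thermal-floor`: `ExcessDensityIdentity`, `StrandEnergyFloor`, `ThermalMassFloor`.
-/

namespace Summit.CriticalPhenomena.Ising3DConformalLimit.Cruxes.IndependentStrandsJoin.Ideator1

open scoped BigOperators Classical symmDiff
open Finset Literature.Probability.LatticeModels

/-- T-JOIN SWITCHING IDENTITY (XOR switching), finite graph, any `t`, four distinct vertices:
`Σ_{F₁ ∈ 𝒯(a₀a₁)} Σ_{F₂ ∈ 𝒯(a₂a₃)} 1[a₀ ↮ a₂ in F₁ ∪ F₂] t^{|F₁|+|F₂|}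
 = Σ_{F⁰ ∈ 𝒯(∅)} Σ_{F' ∈ 𝒯(a₀a₁a₂a₃)} 1[a₀ ~_{F'} a₁ ∧ a₀ ≁_{F'} a₂ ∧ a₀ ↮ a₂ in F⁰ ∪ F'] t^{|F⁰|+|F'|}`.
Proof: `(F₁,F₂) ↦ (F₁ ∆ F₂, F₁ ∩ F₂)`; fibres are cosets of the cycle space of `H = F₁ ∆ F₂`; on
`{a₀ ~_H a₁}` the two source assignments have the same fibres; off it the left event is empty. -/
def NoJoinSwitch : Prop :=
  ∀ (V : Type) [Fintype V] [DecidableEq V] (G : SimpleGraph V) [DecidableRel G.Adj] (t : ℝ)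
    (a : Fin 4 → V), Function.Injective a →
    (∑ F₁ ∈ tJoins G Set.univ {a 0, a 1}, ∑ F₂ ∈ tJoins G Set.univ {a 2, a 3},
        (if (SimpleGraph.fromEdgeSet ((↑F₁ : Set (Sym2 V)) ∪ ↑F₂)).Reachable (a 0) (a 2) then (0 : ℝ)
         else t ^ (#F₁ + #F₂)))
      =
    ∑ F₀ ∈ tJoins G Set.univ (∅ : Finset V), ∑ F' ∈ tJoins G Set.univ {a 0, a 1, a 2, a 3},
        (if (SimpleGraph.fromEdgeSet (↑F' : Set (Sym2 V))).Reachable (a 0) (a 1)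
              ∧ ¬ (SimpleGraph.fromEdgeSet (↑F' : Set (Sym2 V))).Reachable (a 0) (a 2)
              ∧ ¬ (SimpleGraph.fromEdgeSet ((↑F₀ : Set (Sym2 V)) ∪ ↑F')).Reachable (a 0) (a 2)
         then t ^ (#F₀ + #F') else 0)

/-- TETRAHEDRAL SANDWICH (lattice form, free box): with `JoinSum` the double sum of the crux and
`Z⁰ = loopO1PartitionFunction G t ∅`, `U₄^free_{Λ_N}(l·tetra) · (Z⁰)² ≥ -3 · JoinSum`.  Together with
`StrandsJoinBound` (`U₄ (Z⁰)² ≤ -2 JoinSum`): `(2/3)·m ≤ q ≤ m`, `m = |U₄|/(2 τ²)`, `q` = crux probability.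
Proof: `NoJoinSwitch` + the `S₄`-symmetry of `(Λ_N, l·tetra)` (the three pairings are equiprobable under
`ℓ^{0123}`) + `U₄ = S₄ - 3τ²` at the regular tetrahedron. -/
def TetraSandwich : Prop :=
  let tetra : Fin 4 → Site 3 := ![![-1, -1, -1], ![1, 1, -1], ![1, -1, 1], ![-1, 1, 1]];
  ∀ (l N : ℕ) (a : Fin 4 → ↥(box 3 N)), (∀ i, ((a i : Site 3)) = (l : ℤ) • tetra i) → 1 ≤ l →
    (let G := ((zdGraph 3).comap (Subtype.val : ↥(box 3 N) → Site 3));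
     let β : ℝ := criticalBeta 3;
     let t : ℝ := Real.tanh β;
     -(3 * ∑ F₁ ∈ tJoins G Set.univ {a 0, a 1}, ∑ F₂ ∈ tJoins G Set.univ {a 2, a 3},
          (if (SimpleGraph.fromEdgeSet ((↑F₁ : Set (Sym2 ↥(box 3 N))) ∪ ↑F₂)).Reachable (a 0) (a 2)
           then t ^ (#F₁ + #F₂) else 0))
      ≤ connectedFour (isingMeasure G Finset.univ β 0 .free) spinAt a * (loopO1PartitionFunction G t ∅) ^ 2)

/-- TRANSFER `C⁺ → crux`: the lattice form of clause (iii) at tetrahedra in large free boxes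
(`U₄^free_{Λ_N}(l·tetra) ≤ -c · ⟨σ_{a₀}σ_{a₁}⟩⟨σ_{a₂}σ_{a₃}⟩` uniformly) implies `IndependentStrandsJoin`
(with constant `c/3`), by `TetraSandwich` and `⟨σσ⟩^free = Z^{xy}/Z⁰` (`isingCorr_free_eq_hteSum_div`). -/
def JoinFromU4Box : Prop :=
  (let tetra : Fin 4 → Site 3 := ![![-1, -1, -1], ![1, 1, -1], ![1, -1, 1], ![-1, 1, 1]];
   ∃ c : ℝ, 0 < c ∧ ∀ l : ℕ, 1 ≤ l → ∃ N₀ : ℕ, ∀ N : ℕ, N₀ ≤ N → ∀ a : Fin 4 → ↥(box 3 N),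
    (∀ i, ((a i : Site 3)) = (l : ℤ) • tetra i) →
    (let G := ((zdGraph 3).comap (Subtype.val : ↥(box 3 N) → Site 3));
     let β : ℝ := criticalBeta 3;
     connectedFour (isingMeasure G Finset.univ β 0 .free) spinAt a
       ≤ -(c * (isingCorr G Finset.univ β 0 .free {a 0, a 1} * isingCorr G Finset.univ β 0 .free {a 2, a 3}))))
  → Summit.CriticalPhenomena.Ising3DConformalLimit.Theses.FKParityRobustness.IndependentStrandsJoin

/-- UNION-SHADOW IDENTITY (loop-O(1) form of Aizenman's deletion identity, EXACT): for `β ≥ 0`,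
`t = tanh β`, four distinct vertices,
`Σ_{F₁∈𝒯(01)} Σ_{F₂∈𝒯(23)} 1[a₀ ↮ a₂ in F₁∪F₂] t^{|F₁|+|F₂|}
  = Σ_{F₁∈𝒯(01)} Σ_{F⁰∈𝒯(∅)} 1[a₂, a₃ ∉ C] t^{|F₁|+|F⁰|} ⟨σ_{a₂}σ_{a₃}⟩^free_{G ∖ V(C)}`,
`C` = the cluster of `a₀` in `F₁ ∪ F⁰` (vertices deleted = couplings switched off).  Dividing by
`Z^{01} Z^{23}`: `1 - q = E^{ℓ^{01}⊗ℓ^∅}[1[a₂,a₃ ∉ C⁺] ⟨σσ⟩_{G∖V(C⁺)}/⟨σσ⟩_G]`. -/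
def UnionShadowIdentity : Prop :=
  ∀ (V : Type) [Fintype V] [DecidableEq V] (G : SimpleGraph V) [DecidableRel G.Adj] (β : ℝ), 0 ≤ β →
    ∀ (a : Fin 4 → V), Function.Injective a →
    (let t : ℝ := Real.tanh β;
     (∑ F₁ ∈ tJoins G Set.univ {a 0, a 1}, ∑ F₂ ∈ tJoins G Set.univ {a 2, a 3},
        (if (SimpleGraph.fromEdgeSet ((↑F₁ : Set (Sym2 V)) ∪ ↑F₂)).Reachable (a 0) (a 2) then (0 : ℝ)
         else t ^ (#F₁ + #F₂)))
      =
     ∑ F₁ ∈ tJoins G Set.univ {a 0, a 1}, ∑ F₀ ∈ tJoins G Set.univ (∅ : Finset V),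
        (if ¬ (SimpleGraph.fromEdgeSet ((↑F₁ : Set (Sym2 V)) ∪ ↑F₀)).Reachable (a 0) (a 2)
              ∧ ¬ (SimpleGraph.fromEdgeSet ((↑F₁ : Set (Sym2 V)) ∪ ↑F₀)).Reachable (a 0) (a 3)
         then t ^ (#F₁ + #F₀) *
              isingCorr G (Finset.univ.filter (fun v : V =>
                ¬ (SimpleGraph.fromEdgeSet ((↑F₁ : Set (Sym2 V)) ∪ ↑F₀)).Reachable (a 0) v)) β 0 .free {a 2, a 3}
         else 0))

/-- ONE-POINT SWITCHING for the union cluster `C⁺ = C_{F₁∪F⁰}(a₀)`: XOR-connectivity from `a₀` to `u`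
under `ℓ^{a₀a₁} ⊗ ℓ^∅` equals XOR-connectivity under `ℓ^{a₁u} ⊗ ℓ^{a₀u}`, weights included:
`Σ_{F₁∈𝒯(a₀a₁),F⁰∈𝒯(∅)} 1[a₀ ~_{F₁∆F⁰} u] t^{..} = Σ_{F∈𝒯(a₁u),F'∈𝒯(a₀u)} 1[a₀ ~_{F∆F'} u] t^{..}`;
since `{a₀ ~_{F₁∆F⁰} u} ⊆ {u ∈ C⁺}`, `P[u ∈ C⁺] ≥ (τ(a₁,u)τ(a₀,u)/τ(a₀,a₁)) · ℓ^{a₁u}⊗ℓ^{a₀u}[a₀ ~_{F∆F'} u]`. -/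
def OnePointSwitch : Prop :=
  ∀ (V : Type) [Fintype V] [DecidableEq V] (G : SimpleGraph V) [DecidableRel G.Adj] (t : ℝ)
    (a₀ a₁ u : V), a₀ ≠ a₁ → u ≠ a₀ → u ≠ a₁ →
    (∑ F₁ ∈ tJoins G Set.univ {a₀, a₁}, ∑ F₀ ∈ tJoins G Set.univ (∅ : Finset V),
        (if (SimpleGraph.fromEdgeSet (↑(F₁ ∆ F₀) : Set (Sym2 V))).Reachable a₀ u then t ^ (#F₁ + #F₀) else (0 : ℝ)))
      =
    ∑ F ∈ tJoins G Set.univ {a₁, u}, ∑ F' ∈ tJoins G Set.univ {a₀, u},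
        (if (SimpleGraph.fromEdgeSet (↑(F ∆ F') : Set (Sym2 V))).Reachable a₀ u then t ^ (#F + #F') else 0)

/-- LOCAL ATTACHMENT (open, local, dimension-free): in the XOR of two independent critical strand
configurations sharing the endpoint `u` (sources `{a₁,u}` and `{a₀,u}`), `u` stays in the component of
`a₀` with probability `≥ c₀`, uniformly in the free box and the positions.  With `OnePointSwitch` this
is the lower half of `c₀·τ(a₁u)τ(a₀u)/τ(a₀a₁) ≤ P[u ∈ C⁺] ≤ τ(a₁u)τ(a₀u)/τ(a₀a₁)`: the union cluster has
the double-current one-point function up to constants. -/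
def LocalAttach : Prop :=
  ∃ c₀ : ℝ, 0 < c₀ ∧ ∀ (N : ℕ) (a₀ a₁ u : ↥(box 3 N)), a₀ ≠ a₁ → u ≠ a₀ → u ≠ a₁ →
    (let G := ((zdGraph 3).comap (Subtype.val : ↥(box 3 N) → Site 3));
     let t : ℝ := Real.tanh (criticalBeta 3);
     c₀ * loopO1PartitionFunction G t {a₁, u} * loopO1PartitionFunction G t {a₀, u}
       ≤ ∑ F ∈ tJoins G Set.univ {a₁, u}, ∑ F' ∈ tJoins G Set.univ {a₀, u},
          (if (SimpleGraph.fromEdgeSet (↑(F ∆ F') : Set (Sym2 ↥(box 3 N)))).Reachable a₀ u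
           then t ^ (#F + #F') else 0))

/-- EXCESS-DENSITY IDENTITY (exact, finite graph, `β ≥ 0`, `t = tanh β`, edge `s(u,v)` of `G`):
`(Σ_{F∈𝒯(xy), e∈F} t^{|F|})·Z⁰ - (Σ_{F∈𝒯(∅), e∈F} t^{|F|})·Z^{xy}
   = (t/(1-t²)) · (⟨σ_{{x,y}∆{u,v}}⟩ - ⟨σ_xσ_y⟩⟨σ_uσ_v⟩) · (Z⁰)²`
(`ℓ^{xy}[e∈F] - ℓ^∅[e∈F] = t ∂_{t_e} log⟨σ_xσ_y⟩`; free boundary condition). -/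
def ExcessDensityIdentity : Prop :=
  ∀ (V : Type) [Fintype V] [DecidableEq V] (G : SimpleGraph V) [DecidableRel G.Adj] (β : ℝ), 0 ≤ β →
    ∀ (x y u v : V), x ≠ y → G.Adj u v →
    (let t : ℝ := Real.tanh β;
     let e : Sym2 V := s(u, v);
     (∑ F ∈ (tJoins G Set.univ {x, y}).filter (fun F : Finset (Sym2 V) => e ∈ F), t ^ #F) * loopO1PartitionFunction G t ∅
       - (∑ F ∈ (tJoins G Set.univ (∅ : Finset V)).filter (fun F : Finset (Sym2 V) => e ∈ F), t ^ #F) * loopO1PartitionFunction G t {x, y}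
      = t / (1 - t ^ 2) *
         (isingCorr G Finset.univ β 0 .free ({x, y} ∆ {u, v})
           - isingCorr G Finset.univ β 0 .free {x, y} * isingCorr G Finset.univ β 0 .free {u, v})
         * (loopO1PartitionFunction G t ∅) ^ 2)

/-- STRAND ENERGY FLOOR (exact + GKS II, finite graph): the edge `e = s(u,v)` lies in the SOURCE CLUSTER
`K_x(F)` of `F ~ ℓ^{xy}` with probability at least the excess density `ℓ^{xy}[e∈F] - ℓ^∅[e∈F]`
(conditionally on `K`, `F ∖ K ~ ℓ^∅_{G - V(K)}` and `ℓ^∅_H[e∈F] = (t/(1-t²))(⟨σ_uσ_v⟩_H - t)` is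
GKS-monotone in `H`).  Cleared denominators:
`Z⁰·Σ_{F∈𝒯(xy): e∈F, x ~_F u} t^{|F|} ≥ Z⁰·Σ_{F∈𝒯(xy): e∈F} t^{|F|} - Z^{xy}·Σ_{F∈𝒯(∅): e∈F} t^{|F|}`. -/
def StrandEnergyFloor : Prop :=
  ∀ (V : Type) [Fintype V] [DecidableEq V] (G : SimpleGraph V) [DecidableRel G.Adj] (t : ℝ), 0 ≤ t → t < 1 →
    ∀ (x y u v : V), x ≠ y → G.Adj u v →
    (let e : Sym2 V := s(u, v);
     loopO1PartitionFunction G t ∅ *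
         (∑ F ∈ (tJoins G Set.univ {x, y}).filter (fun F : Finset (Sym2 V) => e ∈ F), t ^ #F)
       - loopO1PartitionFunction G t {x, y} *
         (∑ F ∈ (tJoins G Set.univ (∅ : Finset V)).filter (fun F : Finset (Sym2 V) => e ∈ F), t ^ #F)
      ≤ loopO1PartitionFunction G t ∅ *
         ∑ F ∈ (tJoins G Set.univ {x, y}).filter
            (fun F : Finset (Sym2 V) => e ∈ F ∧ (SimpleGraph.fromEdgeSet (↑F : Set (Sym2 V))).Reachable x u), t ^ #F)

/-- THERMAL MASS FLOOR (the `d = 3` input of card 3; open, "ν < 1/(1+η)"-type, margin `y_t - 1 - η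
≈ 0.55` on numerics): the restricted temperature-derivative of `log ⟨σ_{a₂}σ_{a₃}⟩` over the bonds of
the central ball of radius `l` grows faster than `l^{1+δ}` for some `δ > η`: here with the explicit
exponent `11/10`.  By `StrandEnergyFloor` it bounds `E|E(K_{a₂}) ∩ B_l|` from below (strand thickness). -/
def ThermalMassFloor : Prop :=
  let tetra : Fin 4 → Site 3 := ![![-1, -1, -1], ![1, 1, -1], ![1, -1, 1], ![-1, 1, 1]];
  ∃ c : ℝ, 0 < c ∧ ∀ l : ℕ, 1 ≤ l → ∃ N₀ : ℕ, ∀ N : ℕ, N₀ ≤ N → ∀ a : Fin 4 → ↥(box 3 N),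
    (∀ i, ((a i : Site 3)) = (l : ℤ) • tetra i) →
    (let G := ((zdGraph 3).comap (Subtype.val : ↥(box 3 N) → Site 3));
     let β : ℝ := criticalBeta 3;
     c * (l : ℝ) ^ ((11 : ℝ) / 10) * isingCorr G Finset.univ β 0 .free {a 2, a 3}
       ≤ ∑ p ∈ (Finset.univ : Finset (↥(box 3 N) × ↥(box 3 N))).filter
            (fun p => G.Adj p.1 p.2 ∧ ∀ i, |(p.1 : Site 3) i| ≤ (l : ℤ)),
          (isingCorr G Finset.univ β 0 .free ({a 2, a 3} ∆ {p.1, p.2})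
            - isingCorr G Finset.univ β 0 .free {a 2, a 3} * isingCorr G Finset.univ β 0 .free {p.1, p.2}))

end Summit.CriticalPhenomena.Ising3DConformalLimit.Cruxes.IndependentStrandsJoin.Ideator1
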